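import Summits.Ventures.HodgeRepro.Groups
import Summits.Ventures.HodgeRepro.Faces

/-!
# No face is single-class: the corners of a face never lie in one isogeny class (degrees 6 and 8)

Blind re-derivation cell `pub-hodge-repro`, seat `typer` (gen 4).  Continues `Groups.lean` / `Faces.lean`.

Two CM types in one right-translation class `{Φ · g : g ∈ G}` give isogenous abelian varieties
(`A_{Φ·g}` is `A_Φ` with `F` acting through `g`; Deligne LNM 900 endnote M.12 as printed in
`route/SOURCES.md`).  A face `(Φ; π, π′)` is *single-class* when all four corners are right translates
of `Φ` (`IsSingleClass`); its reduced product (Lemma R, `FaceReduce.lean`) would then be the single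
simple variety `A_Φ` and the face class a Pohlmann `4`-set of `Φ` itself.  `route/ROUTE.md` §3.3–§3.5
states that NO face of degree 6, 8 (or 12) is single-class — hence every open instance of S4 lives on
a product with at least two non-isogenous factors.  This file settles the degree-6 and degree-8 cases
by kernel `decide` on the concrete groups of `Groups.lean`, for every complex conjugation of each group
(`C₆`; `C₈`, `C₄ × C₂` with its three central involutions, `C₂³` with its seven, `D₄`, `Q₈`):

* `IsSingleClass T` — every corner is a right translate of the first (`rmul`);
* `not_isSingleClass_face_<G>` — for every CM type `Φ` and every two distinct places, the face
  `faceCorners c Φ p p′` is NOT single-class;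
* translation symmetry (`faceCorners_mul_left`, `isSingleClass_smul_iff`, `faceCorners_conj_right`) and
  the reduction `not_isSingleClass_of_one` (it suffices to check the faces `(Φ; 1, p′)`), used by the
  degree-12 rows of `SingleClass12.lean`.
-/

open Finset
open scoped Pointwise

namespace HodgeRepro

variable {G : Type*} [Group G] [DecidableEq G]

/-- All corners of a quadruple lie in the right-translation class of the first: `T i = T 0 · g_i`. -/
def IsSingleClass (T : Fin 4 → Finset G) : Prop := ∀ i : Fin 4, ∃ g : G, T i = rmul (T 0) g

/-- `IsSingleClass` is decidable on a finite group. -/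
instance [Fintype G] (T : Fin 4 → Finset G) : Decidable (IsSingleClass T) := by
  unfold IsSingleClass; infer_instance

/-- **Degree 6, `C₆`**: no face is single-class (`decide`). -/
theorem not_isSingleClass_face_C6 :
    ∀ Φ ∈ cmTypes cc_C6, ∀ p p' : C6, p' ∉ place cc_C6 p →
      ¬ IsSingleClass (faceCorners cc_C6 Φ p p') := by
  decide +kernel

/-- **Degree 8, `C₈`**: no face is single-class (`decide`). -/
theorem not_isSingleClass_face_C8 :
    ∀ Φ ∈ cmTypes cc_C8, ∀ p p' : C8, p' ∉ place cc_C8 p →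
      ¬ IsSingleClass (faceCorners cc_C8 Φ p p') := by
  decide +kernel

/-- **Degree 8, `C₄ × C₂`**, for each of its three central involutions: no face is single-class. -/
theorem not_isSingleClass_face_C4xC2 :
    ∀ c ∈ complexConjs C4xC2, ∀ Φ ∈ cmTypes c, ∀ p p' : C4xC2, p' ∉ place c p →
      ¬ IsSingleClass (faceCorners c Φ p p') := by
  decide +kernel

/-- The degree-8 `C₂³` census predicate for ONE involution `c`: no face of any CM type for `c` is
single-class.  (Stated as a definition so that the seven involutions can be checked by seven separate
kernel computations — one `decide +kernel` over all seven at once exceeds the kernel's memory budget on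
the farm — and recombined in `not_isSingleClass_face_C2xC2xC2`.) -/
def NoSingleClassFace8 (c : C2xC2xC2) : Prop :=
  ∀ Φ ∈ cmTypes c, ∀ p p' : C2xC2xC2, p' ∉ place c p → ¬ IsSingleClass (faceCorners c Φ p p')

set_option synthInstance.maxSize 1024 in
/-- `NoSingleClassFace8` is decidable (finite quantifiers over an 8-element group; the `Decidable`
instance for the triple product exceeds the default `synthInstance.maxSize`, hence the option). -/
instance : DecidablePred NoSingleClassFace8 := fun c => by unfold NoSingleClassFace8; infer_instance

/-- `C₂³`, involution `(1, 0, 0)`: no face is single-class (one kernel computation). -/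
theorem noSingleClassFace8_100 : NoSingleClassFace8 (Multiplicative.ofAdd (1, 0, 0)) := by
  decide +kernel

/-- `C₂³`, involution `(0, 1, 0)`: no face is single-class. -/
theorem noSingleClassFace8_010 : NoSingleClassFace8 (Multiplicative.ofAdd (0, 1, 0)) := by
  decide +kernel

/-- `C₂³`, involution `(0, 0, 1)`: no face is single-class. -/
theorem noSingleClassFace8_001 : NoSingleClassFace8 (Multiplicative.ofAdd (0, 0, 1)) := by
  decide +kernel

/-- `C₂³`, involution `(1, 1, 0)`: no face is single-class. -/
theorem noSingleClassFace8_110 : NoSingleClassFace8 (Multiplicative.ofAdd (1, 1, 0)) := by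
  decide +kernel

/-- `C₂³`, involution `(1, 0, 1)`: no face is single-class. -/
theorem noSingleClassFace8_101 : NoSingleClassFace8 (Multiplicative.ofAdd (1, 0, 1)) := by
  decide +kernel

/-- `C₂³`, involution `(0, 1, 1)`: no face is single-class. -/
theorem noSingleClassFace8_011 : NoSingleClassFace8 (Multiplicative.ofAdd (0, 1, 1)) := by
  decide +kernel

/-- `C₂³`, involution `(1, 1, 1)`: no face is single-class. -/
theorem noSingleClassFace8_111 : NoSingleClassFace8 (Multiplicative.ofAdd (1, 1, 1)) := by
  decide +kernel

/-- Every non-identity element of `C₂³` is one of the seven listed involutions (an 8-element check). -/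
theorem C2xC2xC2_ne_one_mem (c : C2xC2xC2) (hc : c ≠ 1) :
    c ∈ ({Multiplicative.ofAdd (1, 0, 0), Multiplicative.ofAdd (0, 1, 0), Multiplicative.ofAdd (0, 0, 1),
      Multiplicative.ofAdd (1, 1, 0), Multiplicative.ofAdd (1, 0, 1), Multiplicative.ofAdd (0, 1, 1),
      Multiplicative.ofAdd (1, 1, 1)} : Finset C2xC2xC2) := by
  revert c; decide

/-- **Degree 8, `C₂³`**, for each of its seven involutions (`complexConjs C2xC2xC2 = univ.erase 1`,
`Groups.lean`): no face is single-class.  Assembled from the seven one-involution kernel computations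
`noSingleClassFace8_*` through the enumeration `C2xC2xC2_ne_one_mem`. -/
theorem not_isSingleClass_face_C2xC2xC2 :
    ∀ c : C2xC2xC2, c ≠ 1 → ∀ Φ ∈ cmTypes c, ∀ p p' : C2xC2xC2, p' ∉ place c p →
      ¬ IsSingleClass (faceCorners c Φ p p') := by
  intro c hc
  have hmem := C2xC2xC2_ne_one_mem c hc
  simp only [Finset.mem_insert, Finset.mem_singleton] at hmem
  rcases hmem with rfl | rfl | rfl | rfl | rfl | rfl | rfl
  · exact noSingleClassFace8_100
  · exact noSingleClassFace8_010
  · exact noSingleClassFace8_001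
  · exact noSingleClassFace8_110
  · exact noSingleClassFace8_101
  · exact noSingleClassFace8_011
  · exact noSingleClassFace8_111

/-- **Degree 8, `D₄`**: no face is single-class. -/
theorem not_isSingleClass_face_D4 :
    ∀ Φ ∈ cmTypes cc_D4, ∀ p p' : D4, p' ∉ place cc_D4 p →
      ¬ IsSingleClass (faceCorners cc_D4 Φ p p') := by
  decide +kernel

/-- **Degree 8, `Q₈`**: no face is single-class. -/
theorem not_isSingleClass_face_Q8 :
    ∀ Φ ∈ cmTypes cc_Q8, ∀ p p' : Q8, p' ∉ place cc_Q8 p →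
      ¬ IsSingleClass (faceCorners cc_Q8 Φ p p') := by
  decide +kernel

/-! ### Translation symmetry: reduce the first place to the identity embedding -/

section Symmetry

variable {c : G} (hc : IsComplexConj c)
include hc

/-- The place of `g * p` is the left translate of the place of `p` (`c` central). -/
theorem place_mul_left (g p : G) : place c (g * p) = g • place c p := by
  ext x
  rw [mem_place, Finset.mem_smul_finset]
  constructor
  · rintro (rfl | rfl)
    · exact ⟨p, mem_place_self c p, rfl⟩
    · exact ⟨c * p, conj_mem_place c p, by rw [smul_eq_mul, ← mul_assoc, ← hc.comm, mul_assoc]⟩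
  · rintro ⟨y, hy, rfl⟩
    rw [mem_place] at hy
    rcases hy with rfl | rfl
    · exact Or.inl rfl
    · right
      rw [smul_eq_mul, ← mul_assoc, ← hc.comm, mul_assoc]

/-- Flipping the translate `g • S` at the translated place is the translate of the flip. -/
theorem flipAt_mul_left (g p : G) (S : Finset G) :
    flipAt c (g * p) (g • S) = g • flipAt c p S := by
  unfold flipAt
  rw [place_mul_left hc, Finset.smul_finset_symmDiff]

/-- Flipping at the conjugate place representative is the same flip. -/
theorem flipAt_conj_left (p : G) (S : Finset G) : flipAt c (c * p) S = flipAt c p S := by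
  have hpl : place c (c * p) = place c p := by
    ext x
    rw [mem_place, mem_place, hc.mul_mul_cancel]
    tauto
  unfold flipAt
  rw [hpl]

/-- The face of the translated type at the translated places is the translate of the face. -/
theorem faceCorners_mul_left (g : G) (Φ : Finset G) (p p' : G) :
    faceCorners c (g • Φ) (g * p) (g * p') = fun i => g • faceCorners c Φ p p' i := by
  funext i
  fin_cases i
  · rfl
  · show flipAt c (g * p) (c • g • Φ) = g • flipAt c p (c • Φ)
    rw [hc.smul_comm_finset, flipAt_mul_left hc]
  · show flipAt c (g * p') (c • g • Φ) = g • flipAt c p' (c • Φ)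
    rw [hc.smul_comm_finset, flipAt_mul_left hc]
  · show flipAt c (g * p') (flipAt c (g * p) (g • Φ)) = g • flipAt c p' (flipAt c p Φ)
    rw [flipAt_mul_left hc, flipAt_mul_left hc]

/-- A face depends on its second place only through the place: `(Φ; p, c p′) = (Φ; p, p′)`. -/
theorem faceCorners_conj_right (Φ : Finset G) (p p' : G) :
    faceCorners c Φ p (c * p') = faceCorners c Φ p p' := by
  funext i
  fin_cases i
  · rfl
  · rfl
  · show flipAt c (c * p') (c • Φ) = flipAt c p' (c • Φ)
    rw [flipAt_conj_left hc]
  · show flipAt c (c * p') (flipAt c p Φ) = flipAt c p' (flipAt c p Φ)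
    rw [flipAt_conj_left hc]

omit hc in
/-- Left and right translations commute. -/
theorem rmul_smul_comm (g h : G) (S : Finset G) : rmul (g • S) h = g • rmul S h := by
  ext x
  rw [mem_rmul, ← Finset.inv_smul_mem_iff, ← Finset.inv_smul_mem_iff, mem_rmul, smul_eq_mul,
    smul_eq_mul, mul_assoc]

omit hc in
/-- Single-class-ness is invariant under left translation of all corners. -/
theorem isSingleClass_smul_iff (g : G) (T : Fin 4 → Finset G) :
    IsSingleClass (fun i => g • T i) ↔ IsSingleClass T := by
  unfold IsSingleClass
  simp only [rmul_smul_comm, smul_left_cancel_iff]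

variable [Fintype G]

/-- **Reduction to the identity embedding**: if no face `(Φ; 1, p′)` is single-class then no face
`(Φ; p, p′)` is (translate by `p⁻¹`). -/
theorem not_isSingleClass_of_one
    (h1 : ∀ Φ : Finset G, IsCMType c Φ → ∀ p' : G, p' ∉ place c 1 →
      ¬ IsSingleClass (faceCorners c Φ 1 p')) :
    ∀ Φ : Finset G, IsCMType c Φ → ∀ p p' : G, p' ∉ place c p →
      ¬ IsSingleClass (faceCorners c Φ p p') := by
  intro Φ hΦ p p' hp' hsc
  have e : faceCorners c (p⁻¹ • Φ) (p⁻¹ * p) (p⁻¹ * p') = fun i => p⁻¹ • faceCorners c Φ p p' i :=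
    faceCorners_mul_left hc p⁻¹ Φ p p'
  rw [inv_mul_cancel] at e
  have hpl : place c (p⁻¹ * p) = p⁻¹ • place c p := place_mul_left hc p⁻¹ p
  rw [inv_mul_cancel] at hpl
  refine h1 (p⁻¹ • Φ) (hΦ.smul hc p⁻¹) (p⁻¹ * p') ?_ ?_
  · intro hmem
    rw [hpl, ← smul_eq_mul, Finset.smul_mem_smul_finset_iff] at hmem
    exact hp' hmem
  · rw [e, isSingleClass_smul_iff]
    exact hsc

end Symmetry

end HodgeRepro
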